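import Literature.MathematicalPhysics.QuantumFieldTheory.BalabanImbrieJaffe1984to88.BIJ88Eq596Sectors
import Literature.MathematicalPhysics.QuantumFieldTheory.BalabanImbrieJaffe1984to88.BIJ88Eq596SlotsByName
import Literature.MathematicalPhysics.QuantumFieldTheory.BalabanImbrieJaffe1984to88.BIJ88Eq596Insertions

/-!
# `BalabanImbrieJaffe1984to88.BIJ88Eq596BySteps` — T. Bałaban, J. Imbrie, A. Jaffe, *Effective action and cluster properties of the abelian
Higgs model*, Commun. Math. Phys. **114** (1988) 257–315 [BalabanImbrieJaffe1988], (5.9.6) p. 297 [PDF 41] with Sect. 5.4 p. 282 [PDF 26]: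
*"The background gauge transformation u_{k,b} → u′_{k,b} = u_{k,b} exp(−ie_kη(∂Λ̄₃^{(k)}C_k□A′)(b)), φ(x) → φ(x) exp(ie_k(Λ̄₃^{(k)}C_k□A′)(x)), ψ(y) →
ψ(y) exp(ie_k(Λ̄₃^{(k)}C_k□A′)(y)), (5.4.5) is now performed on the term localized in □₀. The background field becomes u′_k = … (5.4.6)"*, p. 283
[PDF 27]: *"We can gauge away the term ∂C_kΛ₃^{(k)*}A′, leaving us with the following background gauge field for the normalization factors: …
(5.4.10)"*, and the inductive assumption (4.16) p. 276 [PDF 20]: *"Finally, we assume that every factor or term in our starting expression is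
gauge invariant in the following senses. Gauge transformations u_{k,b} → u_{k,b}e^{−ie_kη(∂^ηλ)(b)}, φ(x) → φ(x)e^{ie_kλ(x)} (4.16) leave each
expression invariant."*, with (5.1.4) p. 278: *"Since u_k also transforms by λ, we have Q(u_k)φ invariant as well"* — **THE TWO REMAINING PRINTED
STEPS OF `h59` ON THE (4.1) SLOTS — THE ROTATION (5.4.5)–(5.4.6) AND THE p. 283 GAUGE-AWAY — AS ADAPTER THEOREMS FED BY (4.16)-CLAUSES, AND
(5.9.6) AT MEASURE LEVEL WITH EVERY PRINTED STEP ENTERING BY NAME.**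

statement-level skeleton of published theorems with citation tags; proofs where landed; nothing here is a claim about the Yang–Mills mass gap

WHAT THIS FILE DOES (row `C2.Eq5.9.6` of `HOME/lit-balaban-r16/ROWS-C2-part2.md`, owner r16; flip rule of record ROWS v2.159: *"the three
printed STEPS still displayed must be fed by name — (2) the (5.4.5)–(5.4.6) rotation `h546` on the Term41 slots (… the ADAPTER to the abstract
slots is the missing piece), (4) `hgauge` (p.283 gauge-away), (5) the §5.9 support claim `hins`"*; (5) is this seat's `BIJ88Eq596Insertions`).
* §1 **THE ROTATION ADAPTER.**  `RotationReading` = the data (5.4.5) takes on a configuration: the η-lattice function `λ = Λ̄₃^{(k)}C_k□A′` (term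
  dependent through `□ ⊃ □₀`), its values at the points of `T₁^{(k)}` and of `T^{(k+1)}`, and the two slots of (4.1)/(5.2.8) that depend on the
  unit-lattice field only THROUGH the background `u_k` — `Q(u_k)` and `𝒫_{k,loc}(Λ₈′, ·, u_k)` — as functions of the background; `ukRot`/`phiRot`/
  `psiRot` = the printed transformed objects `u′_k`, `φ′`, `ψ′` of (5.4.5) (r18's (4.16) maps `bgGaugeU`/`bgGaugePhi`, verbatim the printed
  exponentials); `sMid1` = the three *"original expressions"* of p. 287 at `(u′_k, φ′, ψ′)` — the entry `mid1` of `BIJ88Eq596Sectors.hS_of_steps`.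
  PROVED: `gaussQuad_bgGaugePhi` (the ψ-Gaussian `½aL⁻²|ψ − Q(u_k)φ|²` is unchanged under a common rotation of `ψ` and `Q(u_k)φ`),
  `scalarForm_bg_of_kernel` (⟨φ, Δ_{k,loc}(u_k)φ⟩ is unchanged when the kernel is gauge COVARIANT — the entrywise form of (4.16) for `Δ_{k,loc}`),
  and **`h546_byName`**: hypothesis `h546` of `hS_of_steps` HOLDS with `mid1 := sMid1`, fed by the clauses (4.16)/(5.1.4) ON THE SLOTS at the
  configuration — `hQcov` (`Q(u′_k)φ′ = e^{ie_kλ}Q(u_k)φ`, the shape of gen 7's torus theorem `BIJ88RT51Background.qCov_barU_gaugeAct`), `hΔ`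
  (`⟨φ′, Δ_{k,loc}(u′_k)φ′⟩ = ⟨φ, Δ_{k,loc}(u_k)φ⟩`, the shape of p31's `BIJ88DeltaLoc234Torus.scalarForm_sum_gaugeAct`), `hPinv` (`𝒫_{k,loc}` invariant)
  — and the readings `hQread`/`hPread` (the `Q`-slot of the (5.2.8) frame and the `𝒫_{k,loc}`-slot of (4.1) factor through `u_k`).
* §2 **THE GAUGE-AWAY ADAPTER.**  **`hgauge_byName`**: hypothesis `hgauge` of `BIJ88Eq596Sectors.hZ_of_steps` HOLDS with `Zmid := Π_j Z^{(j)}_v ·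
  Zloc(M_j) 1` (the entry consumed by this seat's `h5713_byName`), fed by `hZaway` ((4.16) for the normalization factors `Z^{(j)}(u_k)` at the
  gauge function `λ_Z = C_k(Λ₃^{(k)*}A′)` of p. 283 — the torus identity for the resulting background is p31's `BIJ88Eq5410Torus.eq5410_torus`) and
  the reading `hZread` (the factor at the background (5.4.10) is p13's Gaussian family of Sect. 5.7 at `e′ = 1`) with `hZv`.
* §3 **THE ASSEMBLY.**  `zQ`/`zW` (the two halves of `zQW`), `fillSteps` (the (5.9.6) table with the (G)/(S) entries of `BIJ88Eq596SlotsByName.fillOps`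
  and `R^{(k)}`, `ΣW₁`, `Π[ZZ(u_{k+1})]`, `Q^{(k)}`, `ΣW₂` from the Sect. 5.6/5.7 readings), `hG_byName`/`hS_byName`/`hZ_byName` (the three sector
  identities of `h59_of_sectors` for the filled table, each the composite of its printed steps BY NAME: (5.3.5)∘(5.5.12); (5.4.5)–(5.4.6)∘(5.6.13)∘
  (5.8.3); gauge-away∘(5.7.13)), and **`eq596_bySteps`** = `BIJ88Eq596Sectors.eq596_of_sectors_filled` with (G), (S), (Z) so fed: (5.9.6) at measure
  level whose hypotheses are the standing data of `eq596_printed`, the dictionaries' `Laws` (p02) and regularity (p13: `M_j` positive on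
  `[0,1]`, `C^{n̄+1}`), the (4.16)-clauses `hQcov`/`hΔ`/`hPinv`/`hZaway`, the READINGS `hread` (5.3.2), `hQread`, `hPread`, `hreadS` ((5.6.14)
  family at `e′ = 0` = the (5.8.1)-read forms + `𝒫_{k,loc}`), `hZread`/`hZv`, and (C) `hins` (discharged from the printed bounds in
  `BIJ88Eq596Insertions.hins_of_bounds`).
* §4 (v1.1, append-only) **`eq596_bySteps_ins`**: `eq596_bySteps` with (C) discharged too — `χ_ins := BIJ88Eq596Insertions.chiIns` (r16's printed
  `χ_{k+1,Λ₀^{(k)′}}χ′_{Λ₇^{(k)}}` of record) and `hins := hins_of_bounds` — so that ALL THREE STEPS (2)/(4)/(5) of the flip rule enter by name in ONE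
  theorem concluding (5.9.6) at measure level; displayed: standing data, `Laws`/regularity, the (4.16)-clauses, the readings, and the five
  printed bounds (5.9.1)–(5.9.5) on the support of `ζχ·χ_k` (rows C2.Eq5.9.1-5.9.2 / 5.9.3 / 5.9.4-5.9.5).

HONEST SCOPE.  The (4.16)-clauses are the paper's standing inductive ASSUMPTION on the terms of (4.1), displayed here per slot at the
configuration (not proved: they are properties of the concrete kernels, PROVED in the tree for the concrete torus objects — gen 7
`qCov_barU_gaugeAct`, p31 `scalarForm_sum_gaugeAct`, r18 `gaussWeight_twist` — whose identification with the abstract slots is the readings'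
affair); the readings are displayed, not proved; `Laws` are clauses.  Definitions with bodies and theorems; 0 `sorry`; NO `Prop`-valued fact;
imports this seat's `BIJ88Eq596Sectors`, `BIJ88Eq596SlotsByName`, and (v1.1) `BIJ88Eq596Insertions` (Literature + Mathlib); standard axioms.
v1.1 = v1.0 + §4 appended + one import; every v1.0 declaration unchanged.  Pages re-read as images this session:
p. 282 [PDF 26] (r16's render `original-p026-x2.png`), p. 296 [PDF 40], p. 297 [PDF 41]; p. 283 and (4.16) p. 276 quoted from the tree's verbatim
transcriptions (`BIJ88Eq5410Torus`, `BIJ88Sect4Statements`).  Seat p34 gen 13 (unit `lit-balaban-p34-g13`; TAKING line HOME/STATUS.md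
2026-08-22T12:11:44Z).
-/

open scoped RealInnerProductSpace

namespace Literature.MathematicalPhysics.QuantumFieldTheory.BalabanImbrieJaffe1984to88.BIJ88Eq596BySteps

open Literature.MathematicalPhysics.QuantumFieldTheory.Balaban1983to89
open BIJ88Sect3Statements (U1 cfg)
open BIJ85Sect1Model (HiggsField)
open BIJ88Sect4Statements (bgGaugeU bgGaugePhi)
open BIJ88RenormTransf311 (axialMeasure axialBonds gaussWeight DeltaAx)
open BIJ88InductiveForm41 (Prev Term41 gaugeForm scalarForm)
open BIJ85BlockAveragesTorus (qU)
open BIJ88RT52Restrictions (Fields fieldsMeasure IsRD)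
open BIJ88Eq596Display (uCut IsDT)
open BIJ88RT552Transl (bondMul)
open BIJ88Eq596Frame (Entry Bracket596 bracket596)
open BIJ88Eq596Density (rho596 renamedBracket)
open BIJ88Eq596Sectors (uOrig phiOrig psiOrig rho528 gaussQuad fill41 hG_of_steps hS_of_steps hZ_of_steps eq596_of_sectors_filled)
open BIJ88Eq596SlotsByName (GaugeReading ScalarReading ExpansionReading ZReading gLHS gQ1' sMid2 eRk eW1 zZf zQW fillOps
  h535_byName h5512_byName h583_byName h5613_byName h5713_byName)
open BIJ88PertQ5715 (Zloc pertQ5715 remW5713)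
open scoped BigOperators
open _root_.MeasureTheory Complex

noncomputable section

variable {P : Params} {k : ℕ}

/-! ## §1 (5.4.5)–(5.4.6): the rotation adapter on the (4.1)/(5.2.8) slots -/

section Rotation

variable {ι : Type*}

/-- kernel: `|e^{ie_kλ(x)}| = 1`. [cite: BalabanImbrieJaffe1988, (4.16) p.276] -/
theorem norm_exp_I_mul_real (r : ℝ) : ‖Complex.exp (I * (r : ℂ))‖ = 1 := by
  rw [mul_comm]; exact Complex.norm_exp_ofReal_mul_I r

/-- **The ψ-Gaussian of (5.2.8) under the rotation (5.4.5)**: `½aL⁻²Σ_y L^d|ψ(y) − (Q(u_k)φ)(y)|²` is unchanged when `ψ` and `Q(u_k)φ` are both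
multiplied by `e^{ie_kλ(y)}` (p. 282: *"ψ(y) → ψ(y) exp(ie_k(Λ̄₃^{(k)}C_k□A′)(y))"* with (5.1.4) *"Q(u_k)φ invariant as well"*; the concrete
statement is r18's `BIJ88BlockGauge417.gaussWeight_twist`). [cite: BalabanImbrieJaffe1988, (5.4.5) p.282] -/
theorem gaussQuad_bgGaugePhi (a ek : ℝ) (lam : Balaban1983to89.Site P (k+1) → ℝ) (cφ ψ : HiggsField P (k+1)) :
    gaussQuad (P := P) (k := k) a (bgGaugePhi ek lam cφ) (bgGaugePhi ek lam ψ) = gaussQuad (P := P) (k := k) a cφ ψ := by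
  unfold gaussQuad
  congr 1
  refine Finset.sum_congr rfl fun y _ => ?_
  simp only [bgGaugePhi]
  rw [← sub_mul, norm_mul, norm_exp_I_mul_real, mul_one]

/-- **`⟨Λ₈′φ, Δ_{k,loc}(u_k)Λ₈′φ⟩` under (5.4.5) from the entrywise (4.16)-covariance of the kernel**: if
`Δ_{k,loc}(u′_k; x, y) = e^{ie_kλ(x)}Δ_{k,loc}(u_k; x, y)e^{−ie_kλ(y)}` on `Λ₈′ × Λ₈′` for `u′_k = u_k e^{−ie_kη∂^ηλ}`, then
`⟨φ′, Δ_{k,loc}(u′_k)φ′⟩ = ⟨φ, Δ_{k,loc}(u_k)φ⟩` for `φ′ = φe^{ie_kλ}` (r18's `scalarForm`; the concrete statement is p31's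
`BIJ88DeltaLoc234Torus.scalarForm_term_gaugeAct`/`scalarForm_sum_gaugeAct`). [cite: BalabanImbrieJaffe1988, (4.16) p.276] -/
theorem scalarForm_bg_of_kernel (T : Term41 P k) (ek η : ℝ) (lam0 : Balaban1983to89.Site P 0 → ℝ) (lamk : Balaban1983to89.Site P k → ℝ)
    (uk : PBond P 0 → ℂ) (φ : HiggsField P k)
    (hker : ∀ x ∈ T.Λ8, ∀ y ∈ T.Λ8, T.Δloc (bgGaugeU ek η lam0 uk) x y =
      Complex.exp (I * (ek * lamk x : ℝ)) * T.Δloc uk x y * Complex.exp (-(I * (ek * lamk y : ℝ)))) :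
    scalarForm T (bgGaugeU ek η lam0 uk) (bgGaugePhi ek lamk φ) = scalarForm T uk φ := by
  unfold scalarForm
  congr 1
  refine Finset.sum_congr rfl fun x hx => Finset.sum_congr rfl fun y hy => ?_
  rw [hker x hx y hy]
  simp only [bgGaugePhi, map_mul]
  have h1 : (starRingEnd ℂ) (Complex.exp (I * (ek * lamk x : ℝ))) * Complex.exp (I * (ek * lamk x : ℝ)) = 1 := by
    rw [← Complex.exp_conj, map_mul, Complex.conj_I, Complex.conj_ofReal, ← Complex.exp_add]
    convert Complex.exp_zero using 2
    ring
  have h2 : Complex.exp (-(I * (ek * lamk y : ℝ))) * Complex.exp (I * (ek * lamk y : ℝ)) = 1 := by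
    rw [← Complex.exp_add, neg_add_cancel, Complex.exp_zero]
  calc (starRingEnd ℂ) (φ x) * (starRingEnd ℂ) (Complex.exp (I * (ek * lamk x : ℝ))) *
        (Complex.exp (I * (ek * lamk x : ℝ)) * T.Δloc uk x y * Complex.exp (-(I * (ek * lamk y : ℝ)))) *
        (φ y * Complex.exp (I * (ek * lamk y : ℝ)))
      = (starRingEnd ℂ) (φ x) * T.Δloc uk x y * φ y *
          ((starRingEnd ℂ) (Complex.exp (I * (ek * lamk x : ℝ))) * Complex.exp (I * (ek * lamk x : ℝ))) *
          (Complex.exp (-(I * (ek * lamk y : ℝ))) * Complex.exp (I * (ek * lamk y : ℝ))) := by ring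
    _ = (starRingEnd ℂ) (φ x) * T.Δloc uk x y * φ y := by rw [h1, h2, mul_one, mul_one]

variable (P k ι) in
/-- **The data the rotation (5.4.5) takes on a configuration**, per term: `e_k`, `η`; the η-lattice function `λ = Λ̄₃^{(k)}C_k□A′` read on the
configuration (`lam0`; term dependent: *"□ is a ½r(e_k)-cube in T₁^{(k)*} containing a collar neighborhood around □₀"*, p. 281) and its values at
the points of `T₁^{(k)}` (`lamk`, the rotation of `φ`) and of `T^{(k+1)}` (`lamL`, the rotation of `ψ`); and the two slots that depend on the
unit-lattice field only through the background `u_k` — `Q(u_k)` (`QB`, (5.1.4)) and `𝒫_{k,loc}(Λ₈^{(k−1)′}, ·, u_k)` (`PB`, (4.1)) — as functions of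
the background.  (The consistency of `lamk`, `lamL` with `lam0` along the lattice embeddings `T₁^{(k)}, T^{(k+1)} ⊂ T_η` is part of the reading —
it is what the torus theorems feeding the clauses `hQcov`/`hΔ` of `h546_byName` require — and is not used by the adapter itself.)
[cite: BalabanImbrieJaffe1988, (5.4.5) p.282] -/
structure RotationReading where
  /-- `e_k` -/
  ek : ℝ
  /-- `η = L^{−k}ε⁻¹`-lattice spacing of `T_η` -/
  η : ℝ
  /-- `λ = Λ̄₃^{(k)}C_k□A′` on `T_η`, read -/
  lam0 : ι → Prev P k → GaugeField P k U1 → GaugeField P (k+1) U1 → Balaban1983to89.Site P 0 → ℝ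
  /-- `λ` at the points of `T₁^{(k)}` -/
  lamk : ι → Prev P k → GaugeField P k U1 → GaugeField P (k+1) U1 → Balaban1983to89.Site P k → ℝ
  /-- `λ` at the points of `T^{(k+1)}` -/
  lamL : ι → Prev P k → GaugeField P k U1 → GaugeField P (k+1) U1 → Balaban1983to89.Site P (k+1) → ℝ
  /-- `Q(u_k)` as a function of the background `u_k` -/
  QB : ι → Prev P k → (PBond P 0 → ℂ) → HiggsField P k → HiggsField P (k+1)
  /-- `𝒫_{k,loc}(Λ₈^{(k−1)′}, φ, u_k)` as a function of the background `u_k` -/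
  PB : ι → Prev P k → (PBond P 0 → ℂ) → HiggsField P k → ℝ

/-- **`u′_k` of (5.4.5)**: `u′_{k,b} = u_{k,b} exp(−ie_kη(∂λ)(b))`, `u_k` = the (4.2) slot of the term at the original variables (r18's (4.16)
map `bgGaugeU`). [cite: BalabanImbrieJaffe1988, (5.4.5) p.282] -/
def ukRot (R : RotationReading P k ι) (T : ι → Term41 P k) (Λ : ι → Finset (PBond P (k+1)))
    (s : ι → GaugeField P (k+1) U1 → GaugeField P k U1) (t : ι) (prev : Prev P k) (u' : GaugeField P k U1)
    (v : GaugeField P (k+1) U1) : PBond P 0 → ℂ :=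
  bgGaugeU R.ek R.η (R.lam0 t prev u' v) ((T t).uk prev (cfg (uOrig Λ s t u' v)))

/-- **`φ′` of (5.4.5)**: `φ(x) → φ(x) exp(ie_kλ(x))` applied to the original `φ` (r18's `bgGaugePhi`). [cite: BalabanImbrieJaffe1988, (5.4.5) p.282] -/
def phiRot (R : RotationReading P k ι) (Λ : ι → Finset (PBond P (k+1))) (s : ι → GaugeField P (k+1) U1 → GaugeField P k U1)
    (lamφ : ι → Prev P k → GaugeField P k U1 → GaugeField P (k+1) U1 → GaugeTransf P k U1)
    (c : ι → Prev P k → GaugeField P k U1 → GaugeField P (k+1) U1 → HiggsField P (k+1) → HiggsField P k)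
    (t : ι) (prev : Prev P k) (u' : GaugeField P k U1) (v : GaugeField P (k+1) U1) (φ : HiggsField P k) (ψ : HiggsField P (k+1)) :
    HiggsField P k :=
  bgGaugePhi R.ek (R.lamk t prev u' v) (phiOrig Λ s lamφ c t prev u' v φ ψ)

/-- **`ψ′` of (5.4.5)**: `ψ(y) → ψ(y) exp(ie_kλ(y))` applied to the original `ψ`. [cite: BalabanImbrieJaffe1988, (5.4.5) p.282] -/
def psiRot (R : RotationReading P k ι) (Λ : ι → Finset (PBond P (k+1))) (s : ι → GaugeField P (k+1) U1 → GaugeField P k U1)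
    (lamψ : ι → Prev P k → GaugeField P k U1 → GaugeField P (k+1) U1 → GaugeTransf P (k+1) U1)
    (t : ι) (prev : Prev P k) (u' : GaugeField P k U1) (v : GaugeField P (k+1) U1) (ψ : HiggsField P (k+1)) : HiggsField P (k+1) :=
  bgGaugePhi R.ek (R.lamL t prev u' v) (psiOrig Λ s lamψ t prev u' v ψ)

/-- **THE ENTRY `mid1` OF `hS_of_steps` OF RECORD**: the three *"original expressions"* (p. 287) `½aL⁻²|ψ − Q(u_k)φ|² + ½⟨Λ₈′φ, Δ_{k,loc}(u_k)Λ₈′φ⟩ +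
𝒫_{k,loc}(Λ₈′, φ, u_k)` at the transformed objects `(u′_k, φ′, ψ′)` of (5.4.5)–(5.4.6). [cite: BalabanImbrieJaffe1988, (5.4.6) p.282] -/
def sMid1 (R : RotationReading P k ι) (T : ι → Term41 P k) (a : ℝ) (Λ : ι → Finset (PBond P (k+1)))
    (s : ι → GaugeField P (k+1) U1 → GaugeField P k U1)
    (lamφ : ι → Prev P k → GaugeField P k U1 → GaugeField P (k+1) U1 → GaugeTransf P k U1)
    (lamψ : ι → Prev P k → GaugeField P k U1 → GaugeField P (k+1) U1 → GaugeTransf P (k+1) U1)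
    (c : ι → Prev P k → GaugeField P k U1 → GaugeField P (k+1) U1 → HiggsField P (k+1) → HiggsField P k) : Entry P k ι ℝ :=
  fun t prev u' v φ ψ =>
    gaussQuad a (R.QB t prev (ukRot R T Λ s t prev u' v) (phiRot R Λ s lamφ c t prev u' v φ ψ)) (psiRot R Λ s lamψ t prev u' v ψ)
      + (1 / 2 : ℝ) * scalarForm (T t) (ukRot R T Λ s t prev u' v) (phiRot R Λ s lamφ c t prev u' v φ ψ)
      + R.PB t prev (ukRot R T Λ s t prev u' v) (phiRot R Λ s lamφ c t prev u' v φ ψ)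

variable {terms : Finset ι}

/-- **THE STEP (5.4.5)–(5.4.6) OF (S) IN THE SHAPE `h546` OF `BIJ88Eq596Sectors.hS_of_steps`, FED BY THE (4.16)-CLAUSES ON THE SLOTS.**  At every
axial-gauge configuration, with `u_k` the (4.2) slot at the original variables and `(φ, ψ)` the original scalar fields (`phiOrig`, `psiOrig`):
if the `Q`-slot of the (5.2.8) frame is `Q(u_k)` (`hQread`) and transforms by (5.1.4) — `Q(u′_k)φ′ = e^{ie_kλ}·Q(u_k)φ` (`hQcov`); if
`⟨φ′, Δ_{k,loc}(u′_k)φ′⟩ = ⟨φ, Δ_{k,loc}(u_k)φ⟩` (`hΔ`, (4.16) for the scalar form — e.g. from the kernel's covariance by `scalarForm_bg_of_kernel`);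
and if the `𝒫_{k,loc}`-slot is `𝒫_{k,loc}(Λ₈′, φ, u_k)` (`hPread`) and is invariant (`hPinv`, (4.16)) — then the three original expressions at
`(u_k, φ, ψ)` equal the same expressions at `(u′_k, φ′, ψ′)`: `h546` holds with `mid1 := sMid1`.  (*"The background gauge transformation … (5.4.5) is
now performed on the term localized in □₀. The background field becomes u′_k = … (5.4.6)"*.) [cite: BalabanImbrieJaffe1988, (5.4.6) p.282] -/
theorem h546_byName (R : RotationReading P k ι) (T : ι → Term41 P k) (a : ℝ)
    (Qφ : ι → Prev P k → GaugeField P k U1 → HiggsField P k → HiggsField P (k+1))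
    (Λ : ι → Finset (PBond P (k+1))) (s : ι → GaugeField P (k+1) U1 → GaugeField P k U1)
    (lamφ : ι → Prev P k → GaugeField P k U1 → GaugeField P (k+1) U1 → GaugeTransf P k U1)
    (lamψ : ι → Prev P k → GaugeField P k U1 → GaugeField P (k+1) U1 → GaugeTransf P (k+1) U1)
    (c : ι → Prev P k → GaugeField P k U1 → GaugeField P (k+1) U1 → HiggsField P (k+1) → HiggsField P k)
    (hQread : ∀ t ∈ terms, ∀ prev u' v φ ψ, DeltaAx u' →
      Qφ t prev (uOrig Λ s t u' v) (phiOrig Λ s lamφ c t prev u' v φ ψ) =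
        R.QB t prev ((T t).uk prev (cfg (uOrig Λ s t u' v))) (phiOrig Λ s lamφ c t prev u' v φ ψ))
    (hQcov : ∀ t ∈ terms, ∀ prev u' v φ ψ, DeltaAx u' →
      R.QB t prev (ukRot R T Λ s t prev u' v) (phiRot R Λ s lamφ c t prev u' v φ ψ) =
        bgGaugePhi R.ek (R.lamL t prev u' v)
          (R.QB t prev ((T t).uk prev (cfg (uOrig Λ s t u' v))) (phiOrig Λ s lamφ c t prev u' v φ ψ)))
    (hΔ : ∀ t ∈ terms, ∀ prev u' v φ ψ, DeltaAx u' →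
      scalarForm (T t) (ukRot R T Λ s t prev u' v) (phiRot R Λ s lamφ c t prev u' v φ ψ) =
        scalarForm (T t) ((T t).uk prev (cfg (uOrig Λ s t u' v))) (phiOrig Λ s lamφ c t prev u' v φ ψ))
    (hPread : ∀ t ∈ terms, ∀ prev u' v φ ψ, DeltaAx u' →
      (T t).Ploc prev (cfg (uOrig Λ s t u' v)) (phiOrig Λ s lamφ c t prev u' v φ ψ) =
        R.PB t prev ((T t).uk prev (cfg (uOrig Λ s t u' v))) (phiOrig Λ s lamφ c t prev u' v φ ψ))
    (hPinv : ∀ t ∈ terms, ∀ prev u' v φ ψ, DeltaAx u' →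
      R.PB t prev (ukRot R T Λ s t prev u' v) (phiRot R Λ s lamφ c t prev u' v φ ψ) =
        R.PB t prev ((T t).uk prev (cfg (uOrig Λ s t u' v))) (phiOrig Λ s lamφ c t prev u' v φ ψ)) :
    ∀ t ∈ terms, ∀ prev u' v φ ψ, DeltaAx u' →
      gaussQuad a (Qφ t prev (uOrig Λ s t u' v) (phiOrig Λ s lamφ c t prev u' v φ ψ)) (psiOrig Λ s lamψ t prev u' v ψ)
        + (1 / 2 : ℝ) * scalarForm (T t) ((T t).uk prev (cfg (uOrig Λ s t u' v))) (phiOrig Λ s lamφ c t prev u' v φ ψ)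
        + (T t).Ploc prev (cfg (uOrig Λ s t u' v)) (phiOrig Λ s lamφ c t prev u' v φ ψ) =
        sMid1 R T a Λ s lamφ lamψ c t prev u' v φ ψ := by
  intro t ht prev u' v φ ψ hax
  simp only [sMid1]
  rw [hQcov t ht prev u' v φ ψ hax, hΔ t ht prev u' v φ ψ hax, hPinv t ht prev u' v φ ψ hax, hQread t ht prev u' v φ ψ hax,
    hPread t ht prev u' v φ ψ hax, psiRot, gaussQuad_bgGaugePhi]

end Rotation

/-! ## §2 p. 283: the gauge-away adapter for the normalization factors -/

section GaugeAway

variable {ι : Type*} {terms : Finset ι} {nZ : Fin k → Type} [∀ j, Fintype (nZ j)]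

/-- **THE p. 283 STEP OF (Z) IN THE SHAPE `hgauge` OF `BIJ88Eq596Sectors.hZ_of_steps`, FED BY THE (4.16)-CLAUSE FOR THE NORMALIZATION FACTORS.**
*"We can gauge away the term ∂C_kΛ₃^{(k)*}A′, leaving us with the following background gauge field for the normalization factors: … (5.4.10)"*:
if each `Z^{(j)}(u_k)` is invariant under the background gauge transformation `u_k → u_ke^{−ie_kη∂^ηλ_Z}`, `λ_Z = C_k(Λ₃^{(k)*}A′)` (`hZaway`,
(4.16); the torus identity for the resulting background is p31's `BIJ88Eq5410Torus.eq5410_torus`), and the factor at that background is the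
Sect. 5.7 Gaussian family of the term at `e′ = 1` (`hZread`, p13's `Zloc (M_j) 1`), the constants `Z^{(j)}_{Λ₁₀^{c*c}}` read as `hZv`: then
`Π_j[Z^{(j)}_vZ^{(j)}(u_k)] = Π_j[Z^{(j)}_v·Zloc(M_j) 1]` — `hgauge` holds with the `Zmid` consumed by `BIJ88Eq596SlotsByName.h5713_byName`.
[cite: BalabanImbrieJaffe1988, (5.4.10) p.283] -/
theorem hgauge_byName (T : ι → Term41 P k) (Λ : ι → Finset (PBond P (k+1))) (s : ι → GaugeField P (k+1) U1 → GaugeField P k U1)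
    (RZ : ZReading P k ι nZ) (ek η : ℝ) (lamZ : ι → Prev P k → GaugeField P k U1 → GaugeField P (k+1) U1 → Balaban1983to89.Site P 0 → ℝ)
    (hZv : ∀ t ∈ terms, ∀ j, (T t).Zv j = RZ.Zv t j)
    (hZaway : ∀ t ∈ terms, ∀ prev u' v, DeltaAx u' → ∀ j,
      (T t).Zs j ((T t).uk prev (cfg (uOrig Λ s t u' v))) =
        (T t).Zs j (bgGaugeU ek η (lamZ t prev u' v) ((T t).uk prev (cfg (uOrig Λ s t u' v)))))
    (hZread : ∀ t ∈ terms, ∀ prev u' v, DeltaAx u' → ∀ j,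
      (T t).Zs j (bgGaugeU ek η (lamZ t prev u' v) ((T t).uk prev (cfg (uOrig Λ s t u' v)))) = Zloc (RZ.Mf j t prev u' v) 1) :
    ∀ t ∈ terms, ∀ prev u' v (_φ : HiggsField P k) (_ψ : HiggsField P (k+1)), DeltaAx u' →
      (∏ j, (T t).Zv j * (T t).Zs j ((T t).uk prev (cfg (uOrig Λ s t u' v)))) = ∏ j, RZ.Zv t j * Zloc (RZ.Mf j t prev u' v) 1 := by
  intro t ht prev u' v _ _ hax
  exact Finset.prod_congr rfl fun j _ => by rw [hZv t ht j, hZaway t ht prev u' v hax j, hZread t ht prev u' v hax j]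

end GaugeAway

/-! ## §3 The (5.9.6) table with every printed step fed by name; (5.9.6) at measure level -/

section Assembly

variable {ι : Type*} {terms : Finset ι} {ρL : GaugeField P (k+1) U1 → HiggsField P (k+1) → ℂ}
variable {M : Type*} [NormedAddCommGroup M] [InnerProductSpace ℝ M]
variable {M' N' F' : Type*} [NormedAddCommGroup M'] [InnerProductSpace ℝ M'] [NormedAddCommGroup N'] [InnerProductSpace ℝ N']
  [AddCommGroup F'] [Module ℝ F']
variable {nZ : Fin k → Type} [∀ j, Fintype (nZ j)]

/-- entry `Q^{(k)}(u_{k+1}, θ_kH_{k,loc}A^{(k)})` of (5.9.6): the sum over `j` of p13's (5.7.15) expansions of the families.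
[cite: BalabanImbrieJaffe1988, (5.7.15) p.295] -/
def zQ (RZ : ZReading P k ι nZ) : Entry P k ι ℝ := fun t prev u' v _ _ => ∑ j, pertQ5715 (RZ.Mf j t prev u' v) RZ.nbar

/-- entry `Σ_XW₂^{(k)}(X)` of (5.9.6): the sum over `j` of p13's (5.7.13) remainders. [cite: BalabanImbrieJaffe1988, (5.7.13) p.295] -/
def zW (RZ : ZReading P k ι nZ) : Entry P k ι ℝ := fun t prev u' v _ _ => ∑ j, remW5713 (RZ.Mf j t prev u' v) RZ.nbar

/-- `Q^{(k)} + ΣW₂ = zQW` (the combined entry of `BIJ88Eq596SlotsByName`). [cite: BalabanImbrieJaffe1988, (5.7.13) p.295] -/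
theorem zQ_add_zW (RZ : ZReading P k ι nZ) (t : ι) (prev : Prev P k) (u' : GaugeField P k U1) (v : GaugeField P (k+1) U1)
    (φ : HiggsField P k) (ψ : HiggsField P (k+1)) :
    zQ RZ t prev u' v φ ψ + zW RZ t prev u' v φ ψ = zQW RZ t prev u' v φ ψ := by
  simp only [zQ, zW, zQW, ← Finset.sum_add_distrib]

/-- **THE (5.9.6) TABLE FED BY NAME**: the (G)/(S) entries of `BIJ88Eq596SlotsByName.fillOps` (p02's dictionaries read on the configuration) and
`R^{(k)} := eRk`, `ΣW₁ := eW1` (Sect. 5.6 reading), `Π[ZZ(u_{k+1})] := zZf`, `Q^{(k)} := zQ`, `ΣW₂ := zW` (Sect. 5.7 reading); the remaining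
entries (`𝒫_{k,loc}`, and those `fill41` overwrites) are `D`'s. [cite: BalabanImbrieJaffe1988, (5.9.6) p.297] -/
def fillSteps (D : Bracket596 P k ι) (RG : GaugeReading P k ι M) (RS : ScalarReading P k ι M' N' F') (RE : ExpansionReading P k ι)
    (RZ : ZReading P k ι nZ) : Bracket596 P k ι :=
  { fillOps D RG RS with Rk := eRk RE, W1 := eW1 RE, zf := zZf RZ, Qk := zQ RZ, W2 := zW RZ }

variable (D : Bracket596 P k ι) (T : ι → Term41 P k) (a : ℝ)
  (Qφ : ι → Prev P k → GaugeField P k U1 → HiggsField P k → HiggsField P (k+1))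
  (Λ : ι → Finset (PBond P (k+1))) (s : ι → GaugeField P (k+1) U1 → GaugeField P k U1)
  (lamφ : ι → Prev P k → GaugeField P k U1 → GaugeField P (k+1) U1 → GaugeTransf P k U1)
  (lamψ : ι → Prev P k → GaugeField P k U1 → GaugeField P (k+1) U1 → GaugeTransf P (k+1) U1)
  (c : ι → Prev P k → GaugeField P k U1 → GaugeField P (k+1) U1 → HiggsField P (k+1) → HiggsField P k)
  (RG : GaugeReading P k ι M) (RS : ScalarReading P k ι M' N' F') (RE : ExpansionReading P k ι) (RZ : ZReading P k ι nZ)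

/-- **(G) FOR THE FILLED TABLE, BY NAME**: (5.3.5) (`h535_byName`, modulo the reading `hread` of (5.3.2): `½gaugeForm = ½⟨Λ₅′**f^{(k)}, σ_{k,loc}Λ₅′**f^{(k)}⟩`
on the carrier) then (5.5.12) (`h5512_byName`), composed by `hG_of_steps`. [cite: BalabanImbrieJaffe1988, (5.5.12) p.285] -/
theorem hG_byName (hLG : ∀ t ∈ terms, (RG.O t).Laws)
    (hread : ∀ t ∈ terms, ∀ prev u' v, DeltaAx u' → (1 / 2 : ℝ) * gaugeForm (T t) (cfg (uOrig Λ s t u' v)) = gLHS RG t prev u' v) :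
    ∀ t ∈ terms, ∀ prev u' v φ ψ, DeltaAx u' →
      (1 / 2 : ℝ) * gaugeForm (T t) (cfg (uOrig Λ s t u' v)) =
        (fillSteps D RG RS RE RZ).Q1 t prev u' v φ ψ + (fillSteps D RG RS RE RZ).quadA t prev u' v φ ψ / 2
          + (fillSteps D RG RS RE RZ).quadF t prev u' v φ ψ / 2 + (fillSteps D RG RS RE RZ).Q2 t prev u' v φ ψ
          + (fillSteps D RG RS RE RZ).Q3 t prev u' v φ ψ + (fillSteps D RG RS RE RZ).fw3A t prev u' v φ ψ
          + (fillSteps D RG RS RE RZ).fw4f t prev u' v φ ψ / 2 :=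
  hG_of_steps (fillSteps D RG RS RE RZ) T Λ s (gQ1' RG)
    (h535_byName RG hLG (fun t _ u' v => (1 / 2 : ℝ) * gaugeForm (T t) (cfg (uOrig Λ s t u' v))) hread) (h5512_byName RG hLG)

/-- **(S) FOR THE FILLED TABLE, BY NAME**: (5.4.5)–(5.4.6) (`h546_byName`, fed by the (4.16)-clauses and the readings `hQread`/`hPread`), then
(5.6.13) (`h5613_byName` for the Sect. 5.6 family `F` with `S(e_k) := mid1`, modulo the reading `hreadS`: `F(0)` = the (5.8.1)-read forms + `𝒫_{k,loc}`),
then (5.8.3) (`h583_byName`), composed by `hS_of_steps`. [cite: BalabanImbrieJaffe1988, (5.8.3) p.296] -/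
theorem hS_byName (R : RotationReading P k ι)
    (hQread : ∀ t ∈ terms, ∀ prev u' v φ ψ, DeltaAx u' →
      Qφ t prev (uOrig Λ s t u' v) (phiOrig Λ s lamφ c t prev u' v φ ψ) =
        R.QB t prev ((T t).uk prev (cfg (uOrig Λ s t u' v))) (phiOrig Λ s lamφ c t prev u' v φ ψ))
    (hQcov : ∀ t ∈ terms, ∀ prev u' v φ ψ, DeltaAx u' →
      R.QB t prev (ukRot R T Λ s t prev u' v) (phiRot R Λ s lamφ c t prev u' v φ ψ) =
        bgGaugePhi R.ek (R.lamL t prev u' v)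
          (R.QB t prev ((T t).uk prev (cfg (uOrig Λ s t u' v))) (phiOrig Λ s lamφ c t prev u' v φ ψ)))
    (hΔ : ∀ t ∈ terms, ∀ prev u' v φ ψ, DeltaAx u' →
      scalarForm (T t) (ukRot R T Λ s t prev u' v) (phiRot R Λ s lamφ c t prev u' v φ ψ) =
        scalarForm (T t) ((T t).uk prev (cfg (uOrig Λ s t u' v))) (phiOrig Λ s lamφ c t prev u' v φ ψ))
    (hPread : ∀ t ∈ terms, ∀ prev u' v φ ψ, DeltaAx u' →
      (T t).Ploc prev (cfg (uOrig Λ s t u' v)) (phiOrig Λ s lamφ c t prev u' v φ ψ) =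
        R.PB t prev ((T t).uk prev (cfg (uOrig Λ s t u' v))) (phiOrig Λ s lamφ c t prev u' v φ ψ))
    (hPinv : ∀ t ∈ terms, ∀ prev u' v φ ψ, DeltaAx u' →
      R.PB t prev (ukRot R T Λ s t prev u' v) (phiRot R Λ s lamφ c t prev u' v φ ψ) =
        R.PB t prev ((T t).uk prev (cfg (uOrig Λ s t u' v))) (phiOrig Λ s lamφ c t prev u' v φ ψ))
    (F : ι → Prev P k → GaugeField P k U1 → GaugeField P (k+1) U1 → HiggsField P k → HiggsField P (k+1) → ℝ → ℝ) (nbar : ℕ)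
    (δR : Entry P k ι ℝ) (hLS : ∀ t ∈ terms, ∀ prev u' v, (RS.O t prev u' v).Laws)
    (hreadS : ∀ t ∈ terms, ∀ prev u' v φ ψ, DeltaAx u' →
      F t prev u' v φ ψ 0 = sMid2 RS t prev u' v φ ψ + D.Pkloc t prev u' v φ ψ) :
    ∀ t ∈ terms, ∀ prev u' v φ ψ, DeltaAx u' →
      gaussQuad a (Qφ t prev (uOrig Λ s t u' v) (phiOrig Λ s lamφ c t prev u' v φ ψ)) (psiOrig Λ s lamψ t prev u' v ψ)
        + (1 / 2 : ℝ) * scalarForm (T t) ((T t).uk prev (cfg (uOrig Λ s t u' v))) (phiOrig Λ s lamφ c t prev u' v φ ψ)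
        + (T t).Ploc prev (cfg (uOrig Λ s t u' v)) (phiOrig Λ s lamφ c t prev u' v φ ψ) =
        (fillSteps D RG RS ⟨sMid1 R T a Λ s lamφ lamψ c, F, nbar, δR⟩ RZ).Q4 t prev u' v φ ψ
          + (fillSteps D RG RS ⟨sMid1 R T a Λ s lamφ lamψ c, F, nbar, δR⟩ RZ).Q5 t prev u' v φ ψ
          + (fillSteps D RG RS ⟨sMid1 R T a Λ s lamφ lamψ c, F, nbar, δR⟩ RZ).Q6 t prev u' v φ ψ
          + (fillSteps D RG RS ⟨sMid1 R T a Λ s lamφ lamψ c, F, nbar, δR⟩ RZ).quadPhi t prev u' v φ ψ / 2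
          + (fillSteps D RG RS ⟨sMid1 R T a Λ s lamφ lamψ c, F, nbar, δR⟩ RZ).quadPsi t prev u' v φ ψ / 2
          + (fillSteps D RG RS ⟨sMid1 R T a Λ s lamφ lamψ c, F, nbar, δR⟩ RZ).phiW6Psi t prev u' v φ ψ
          + (fillSteps D RG RS ⟨sMid1 R T a Λ s lamφ lamψ c, F, nbar, δR⟩ RZ).psiW7Psi t prev u' v φ ψ / 2
          + (fillSteps D RG RS ⟨sMid1 R T a Λ s lamφ lamψ c, F, nbar, δR⟩ RZ).Pkloc t prev u' v φ ψ
          + (fillSteps D RG RS ⟨sMid1 R T a Λ s lamφ lamψ c, F, nbar, δR⟩ RZ).Rk t prev u' v φ ψ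
          + (fillSteps D RG RS ⟨sMid1 R T a Λ s lamφ lamψ c, F, nbar, δR⟩ RZ).W1 t prev u' v φ ψ :=
  hS_of_steps (fillSteps D RG RS ⟨sMid1 R T a Λ s lamφ lamψ c, F, nbar, δR⟩ RZ) T a Qφ Λ s lamφ lamψ c
    (sMid1 R T a Λ s lamφ lamψ c) (sMid2 RS) (h546_byName R T a Qφ Λ s lamφ lamψ c hQread hQcov hΔ hPread hPinv)
    (h5613_byName ⟨sMid1 R T a Λ s lamφ lamψ c, F, nbar, δR⟩ (sMid2 RS) D.Pkloc hreadS) (h583_byName RS hLS)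

variable [∀ j, DecidableEq (nZ j)]

/-- **(Z) FOR THE FILLED TABLE, BY NAME**: the p. 283 gauge-away (`hgauge_byName`, fed by the (4.16)-clause `hZaway` and the readings `hZread`/`hZv`)
then (5.7.13) (`h5713_byName`, p13's theorem per factor: `M_j` positive on `[0, 1]`, `C^{n̄+1}` entries), composed by `hZ_of_steps`.
[cite: BalabanImbrieJaffe1988, (5.7.13) p.295] -/
theorem hZ_byName (ek η : ℝ) (lamZ : ι → Prev P k → GaugeField P k U1 → GaugeField P (k+1) U1 → Balaban1983to89.Site P 0 → ℝ)
    (hZv : ∀ t ∈ terms, ∀ j, (T t).Zv j = RZ.Zv t j)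
    (hZaway : ∀ t ∈ terms, ∀ prev u' v, DeltaAx u' → ∀ j,
      (T t).Zs j ((T t).uk prev (cfg (uOrig Λ s t u' v))) =
        (T t).Zs j (bgGaugeU ek η (lamZ t prev u' v) ((T t).uk prev (cfg (uOrig Λ s t u' v)))))
    (hZread : ∀ t ∈ terms, ∀ prev u' v, DeltaAx u' → ∀ j,
      (T t).Zs j (bgGaugeU ek η (lamZ t prev u' v) ((T t).uk prev (cfg (uOrig Λ s t u' v)))) = Zloc (RZ.Mf j t prev u' v) 1)
    (hM : ∀ t ∈ terms, ∀ j prev u' v, ∀ e' ∈ Set.uIcc (0 : ℝ) 1, (RZ.Mf j t prev u' v e').PosDef)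
    (hC : ∀ t ∈ terms, ∀ j prev u' v, ∀ i i', ContDiffOn ℝ (RZ.nbar + 1 : ℕ) (fun e' => RZ.Mf j t prev u' v e' i i') (Set.uIcc 0 1)) :
    ∀ t ∈ terms, ∀ prev u' v φ ψ, DeltaAx u' →
      (∏ j, (T t).Zv j * (T t).Zs j ((T t).uk prev (cfg (uOrig Λ s t u' v)))) =
        (fillSteps D RG RS RE RZ).zf t prev u' v φ ψ *
          Real.exp (-((fillSteps D RG RS RE RZ).Qk t prev u' v φ ψ + (fillSteps D RG RS RE RZ).W2 t prev u' v φ ψ)) := by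
  refine hZ_of_steps (fillSteps D RG RS RE RZ) T Λ s (fun t prev u' v _ _ => ∏ j, RZ.Zv t j * Zloc (RZ.Mf j t prev u' v) 1)
    (hgauge_byName T Λ s RZ ek η lamZ hZv hZaway hZread) fun t ht prev u' v φ ψ hax => ?_
  change (∏ j, RZ.Zv t j * Zloc (RZ.Mf j t prev u' v) 1) =
    zZf RZ t prev u' v φ ψ * Real.exp (-(zQ RZ t prev u' v φ ψ + zW RZ t prev u' v φ ψ))
  rw [zQ_add_zW]
  exact h5713_byName RZ hM hC t ht prev u' v φ ψ hax

/-- **(5.9.6) AT MEASURE LEVEL WITH EVERY PRINTED STEP OF `h59` ENTERING BY NAME** — `BIJ88Eq596Sectors.eq596_of_sectors_filled` for the table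
`fillSteps` with (G) := `hG_byName` ((5.3.5), (5.5.12)), (S) := `hS_byName` ((5.4.5)–(5.4.6), (5.6.13), (5.8.3)), (Z) := `hZ_byName` (p. 283
gauge-away, (5.7.13)).  Hypotheses: the standing data of `eq596_printed` (the display (5.2.8) for the bracket of record with integrable brackets,
the p. 282 phases, the p. 284 δ-claims, the (5.8.1) shifts); p02's dictionary `Laws` (`hLG`, `hLS`) and p13's regularity (`hM`, `hC`); the
(4.16)-CLAUSES on the slots (`hQcov`, `hΔ`, `hPinv`, `hZaway`); the READINGS `hread` (5.3.2), `hQread`, `hPread`, `hreadS`, `hZread`, `hZv`; and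
(C) `hins` (the §5.9 support claim — discharged from the printed bounds (5.9.1)–(5.9.5) by `BIJ88Eq596Insertions.hins_of_bounds`).  Conclusion:
line 1 of (5.9.6) for the renamed density with lines 2–8 as the bracket of the filled table, and `∫dvdψ ρ^L_{k+1} = ∫dvdψ ρ̃^L_{k+1}`.
[cite: BalabanImbrieJaffe1988, (5.9.6) p.297] -/
theorem eq596_bySteps (w : ι → Prev P k → GaugeField P k U1 → HiggsField P k → HiggsField P (k+1) → ℝ)
    (hk : k + 1 ≤ P.m + P.K) (h528 : IsRD (axialMeasure P k U1) terms qU Qφ a (rho528 w T) ρL)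
    (hρi : ∀ t ∈ terms, Integrable
      (fun q : Fields P k => rho528 w T t q.2.1 q.1 q.2.2.1 q.2.2.2 * (gaussWeight a (Qφ t q.2.1 q.1 q.2.2.1) q.2.2.2 : ℂ))
      (fieldsMeasure (axialMeasure P k U1)))
    (hmφ : ∀ t ∈ terms, Measurable fun x : GaugeField P k U1 × Prev P k => lamφ t x.2 (uCut qU (Λ t) x.1) (qU x.1))
    (hmψ : ∀ t ∈ terms, Measurable fun x : GaugeField P k U1 × Prev P k => lamψ t x.2 (uCut qU (Λ t) x.1) (qU x.1))
    (hs : ∀ t ∈ terms, ∀ w, ∀ b ∈ (axialBonds : Finset (PBond P k)), s t w b = 1)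
    (S : ι → Set (GaugeField P k U1))
    (hsupp : ∀ t ∈ terms, ∀ prev u' v φ ψ, renamedBracket Qφ a (rho528 w T) Λ lamφ lamψ t prev u' v φ ψ ≠ 0 → u' ∈ S t)
    (hQS : ∀ t ∈ terms, ∀ u' ∈ S t, ∀ w, qU (bondMul u' (s t w)) = qU u' ∧ qU (bondMul u' fun b => (s t w b)⁻¹) = qU u')
    (χins : Entry P k ι ℝ)
    (hins : ∀ t ∈ terms, ∀ prev u' v φ ψ, DeltaAx u' →
      w t prev (uOrig Λ s t u' v) (phiOrig Λ s lamφ c t prev u' v φ ψ) (psiOrig Λ s lamψ t prev u' v ψ) *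
        (T t).chi prev (cfg (uOrig Λ s t u' v)) (phiOrig Λ s lamφ c t prev u' v φ ψ) ≠ 0 → χins t prev u' v φ ψ = 1)
    -- (G): p02's §5.5 dictionary `Laws` and the reading (5.3.2)
    (hLG : ∀ t ∈ terms, (RG.O t).Laws)
    (hread : ∀ t ∈ terms, ∀ prev u' v, DeltaAx u' → (1 / 2 : ℝ) * gaugeForm (T t) (cfg (uOrig Λ s t u' v)) = gLHS RG t prev u' v)
    -- (S): the rotation (5.4.5) with its (4.16)-clauses and readings; the Sect. 5.6 family; p02's §5.8 dictionary `Laws`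
    (R : RotationReading P k ι)
    (hQread : ∀ t ∈ terms, ∀ prev u' v φ ψ, DeltaAx u' →
      Qφ t prev (uOrig Λ s t u' v) (phiOrig Λ s lamφ c t prev u' v φ ψ) =
        R.QB t prev ((T t).uk prev (cfg (uOrig Λ s t u' v))) (phiOrig Λ s lamφ c t prev u' v φ ψ))
    (hQcov : ∀ t ∈ terms, ∀ prev u' v φ ψ, DeltaAx u' →
      R.QB t prev (ukRot R T Λ s t prev u' v) (phiRot R Λ s lamφ c t prev u' v φ ψ) =
        bgGaugePhi R.ek (R.lamL t prev u' v)
          (R.QB t prev ((T t).uk prev (cfg (uOrig Λ s t u' v))) (phiOrig Λ s lamφ c t prev u' v φ ψ)))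
    (hΔ : ∀ t ∈ terms, ∀ prev u' v φ ψ, DeltaAx u' →
      scalarForm (T t) (ukRot R T Λ s t prev u' v) (phiRot R Λ s lamφ c t prev u' v φ ψ) =
        scalarForm (T t) ((T t).uk prev (cfg (uOrig Λ s t u' v))) (phiOrig Λ s lamφ c t prev u' v φ ψ))
    (hPread : ∀ t ∈ terms, ∀ prev u' v φ ψ, DeltaAx u' →
      (T t).Ploc prev (cfg (uOrig Λ s t u' v)) (phiOrig Λ s lamφ c t prev u' v φ ψ) =
        R.PB t prev ((T t).uk prev (cfg (uOrig Λ s t u' v))) (phiOrig Λ s lamφ c t prev u' v φ ψ))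
    (hPinv : ∀ t ∈ terms, ∀ prev u' v φ ψ, DeltaAx u' →
      R.PB t prev (ukRot R T Λ s t prev u' v) (phiRot R Λ s lamφ c t prev u' v φ ψ) =
        R.PB t prev ((T t).uk prev (cfg (uOrig Λ s t u' v))) (phiOrig Λ s lamφ c t prev u' v φ ψ))
    (F : ι → Prev P k → GaugeField P k U1 → GaugeField P (k+1) U1 → HiggsField P k → HiggsField P (k+1) → ℝ → ℝ) (nbar : ℕ)
    (δR : Entry P k ι ℝ) (hLS : ∀ t ∈ terms, ∀ prev u' v, (RS.O t prev u' v).Laws)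
    (hreadS : ∀ t ∈ terms, ∀ prev u' v φ ψ, DeltaAx u' →
      F t prev u' v φ ψ 0 = sMid2 RS t prev u' v φ ψ + D.Pkloc t prev u' v φ ψ)
    -- (Z): the gauge-away with its (4.16)-clause and readings; p13's regularity
    (ek η : ℝ) (lamZ : ι → Prev P k → GaugeField P k U1 → GaugeField P (k+1) U1 → Balaban1983to89.Site P 0 → ℝ)
    (hZv : ∀ t ∈ terms, ∀ j, (T t).Zv j = RZ.Zv t j)
    (hZaway : ∀ t ∈ terms, ∀ prev u' v, DeltaAx u' → ∀ j,
      (T t).Zs j ((T t).uk prev (cfg (uOrig Λ s t u' v))) =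
        (T t).Zs j (bgGaugeU ek η (lamZ t prev u' v) ((T t).uk prev (cfg (uOrig Λ s t u' v)))))
    (hZread : ∀ t ∈ terms, ∀ prev u' v, DeltaAx u' → ∀ j,
      (T t).Zs j (bgGaugeU ek η (lamZ t prev u' v) ((T t).uk prev (cfg (uOrig Λ s t u' v)))) = Zloc (RZ.Mf j t prev u' v) 1)
    (hM : ∀ t ∈ terms, ∀ j prev u' v, ∀ e' ∈ Set.uIcc (0 : ℝ) 1, (RZ.Mf j t prev u' v e').PosDef)
    (hC : ∀ t ∈ terms, ∀ j prev u' v, ∀ i i', ContDiffOn ℝ (RZ.nbar + 1 : ℕ) (fun e' => RZ.Mf j t prev u' v e' i i') (Set.uIcc 0 1)) :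
    IsDT (axialMeasure P k U1) terms Λ qU
        (bracket596 (fill41 (fillSteps D RG RS ⟨sMid1 R T a Λ s lamφ lamψ c, F, nbar, δR⟩ RZ) T w a Λ s lamφ lamψ c χins))
        (rho596 terms Λ (renamedBracket Qφ a (rho528 w T) Λ lamφ lamψ)) ∧
      ∫ v, ∫ ψ, rho596 terms Λ (renamedBracket Qφ a (rho528 w T) Λ lamφ lamψ) v ψ ∂volume ∂fieldMeasure P (k+1) U1 =
        ∫ v, ∫ ψ, ρL v ψ ∂volume ∂fieldMeasure P (k+1) U1 :=
  eq596_of_sectors_filled (fillSteps D RG RS ⟨sMid1 R T a Λ s lamφ lamψ c, F, nbar, δR⟩ RZ) T w a Qφ hk h528 hρi Λ lamφ lamψ hmφ hmψ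
    s hs S hsupp hQS c χins hins
    (hZ_byName D T Λ s RG RS ⟨sMid1 R T a Λ s lamφ lamψ c, F, nbar, δR⟩ RZ ek η lamZ hZv hZaway hZread hM hC)
    (hG_byName D T Λ s RG RS ⟨sMid1 R T a Λ s lamφ lamψ c, F, nbar, δR⟩ RZ hLG hread)
    (hS_byName D T a Qφ Λ s lamφ lamψ c RG RS RZ R hQread hQcov hΔ hPread hPinv F nbar δR hLS hreadS)

end Assembly

/-! ## §4 (v1.1, append-only) (5.9.6) at measure level with (G), (S), (Z) by name AND (C) discharged from the printed bounds -/

section WithInsertions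

open BIJ88Sect3Statements (covD starB starP)
open BIJ88Eq596Insertions (InsertionReading chiIns hins_of_bounds)

variable {ι : Type*} {terms : Finset ι} {ρL : GaugeField P (k+1) U1 → HiggsField P (k+1) → ℂ}
variable {M : Type*} [NormedAddCommGroup M] [InnerProductSpace ℝ M]
variable {M' N' F' : Type*} [NormedAddCommGroup M'] [InnerProductSpace ℝ M'] [NormedAddCommGroup N'] [InnerProductSpace ℝ N']
  [AddCommGroup F'] [Module ℝ F']
variable {nZ : Fin k → Type} [∀ j, Fintype (nZ j)] [∀ j, DecidableEq (nZ j)]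

/-- **(5.9.6) AT MEASURE LEVEL — STEPS (2), (4), (5) OF THE FLIP RULE ALL BY NAME.**  `eq596_bySteps` with the inserted factor of record
`χ_ins := chiIns RI` (r16's `chiNext·chiPrime7` at the read arguments) and the §5.9 support claim DISCHARGED by
`BIJ88Eq596Insertions.hins_of_bounds`: besides the standing data, `Laws`/regularity, the (4.16)-clauses and the readings of `eq596_bySteps`,
the hypotheses are the positivity of the radii and the five printed bounds (5.9.1)–(5.9.5) on the support of `ζχ·χ_k` (axial gauge), in the
shapes of rows C2.Eq5.9.1-5.9.2, C2.Eq5.9.3, C2.Eq5.9.4-5.9.5. [cite: BalabanImbrieJaffe1988, (5.9.6) p.297] -/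
theorem eq596_bySteps_ins (D : Bracket596 P k ι) (T : ι → Term41 P k) (a : ℝ)
    (Qφ : ι → Prev P k → GaugeField P k U1 → HiggsField P k → HiggsField P (k+1))
    (Λ : ι → Finset (PBond P (k+1))) (s : ι → GaugeField P (k+1) U1 → GaugeField P k U1)
    (lamφ : ι → Prev P k → GaugeField P k U1 → GaugeField P (k+1) U1 → GaugeTransf P k U1)
    (lamψ : ι → Prev P k → GaugeField P k U1 → GaugeField P (k+1) U1 → GaugeTransf P (k+1) U1)
    (c : ι → Prev P k → GaugeField P k U1 → GaugeField P (k+1) U1 → HiggsField P (k+1) → HiggsField P k)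
    (RG : GaugeReading P k ι M) (RS : ScalarReading P k ι M' N' F') (RZ : ZReading P k ι nZ)
    (w : ι → Prev P k → GaugeField P k U1 → HiggsField P k → HiggsField P (k+1) → ℝ)
    (hk : k + 1 ≤ P.m + P.K) (h528 : IsRD (axialMeasure P k U1) terms qU Qφ a (rho528 w T) ρL)
    (hρi : ∀ t ∈ terms, Integrable
      (fun q : Fields P k => rho528 w T t q.2.1 q.1 q.2.2.1 q.2.2.2 * (gaussWeight a (Qφ t q.2.1 q.1 q.2.2.1) q.2.2.2 : ℂ))
      (fieldsMeasure (axialMeasure P k U1)))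
    (hmφ : ∀ t ∈ terms, Measurable fun x : GaugeField P k U1 × Prev P k => lamφ t x.2 (uCut qU (Λ t) x.1) (qU x.1))
    (hmψ : ∀ t ∈ terms, Measurable fun x : GaugeField P k U1 × Prev P k => lamψ t x.2 (uCut qU (Λ t) x.1) (qU x.1))
    (hs : ∀ t ∈ terms, ∀ w, ∀ b ∈ (axialBonds : Finset (PBond P k)), s t w b = 1)
    (S : ι → Set (GaugeField P k U1))
    (hsupp : ∀ t ∈ terms, ∀ prev u' v φ ψ, renamedBracket Qφ a (rho528 w T) Λ lamφ lamψ t prev u' v φ ψ ≠ 0 → u' ∈ S t)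
    (hQS : ∀ t ∈ terms, ∀ u' ∈ S t, ∀ w, qU (bondMul u' (s t w)) = qU u' ∧ qU (bondMul u' fun b => (s t w b)⁻¹) = qU u')
    -- (C): the inserted factor of record and the five printed bounds on the support
    (RI : InsertionReading P k ι)
    (hpos : 0 < RI.c * RI.ek * RI.pek ∧ 0 < RI.c * RI.pek * RI.lamk ^ (-(1 / 4 : ℝ)) ∧ 0 < RI.c * RI.pek * RI.s⁻¹ ∧ 0 < RI.c * RI.pek)
    (hbounds : ∀ t ∈ terms, ∀ prev u' v φ ψ, DeltaAx u' →
      w t prev (uOrig Λ s t u' v) (phiOrig Λ s lamφ c t prev u' v φ ψ) (psiOrig Λ s lamψ t prev u' v ψ) *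
        (T t).chi prev (cfg (uOrig Λ s t u' v)) (phiOrig Λ s lamφ c t prev u' v φ ψ) ≠ 0 →
      (∀ p ∈ starP (RI.Λ0' t), ‖RI.rv v p - 1‖ ≤ 9 / 10 * (RI.c * RI.ek * RI.pek)) ∧
      (RI.s ^ P.d < RI.lam → ∀ y ∈ RI.Λ0' t, ‖ψ y‖ ≤ 9 / 10 * (RI.c * RI.pek * RI.lamk ^ (-(1 / 4 : ℝ)))) ∧
      (¬ RI.s ^ P.d < RI.lam → ∀ y ∈ RI.Λ0' t,
        |‖ψ y‖ - (8 * RI.lam) ^ (-(1 / 2 : ℝ)) * RI.s ^ (((P.d : ℝ) - 2) / 2)| ≤ 9 / 10 * (RI.c * RI.pek * RI.s⁻¹)) ∧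
      (∀ b ∈ starB (RI.Λ0' t), ‖covD 1 (RI.rubar t prev u' v) ψ b‖ ≤ 9 / 10 * (RI.c * RI.pek)) ∧
      (∀ b ∈ starB (RI.Λ7 t), |RI.rA u' b| ≤ 9 / 10 * (RI.c * RI.pek)) ∧
      (∀ x ∈ RI.Λ7 t, ‖φ x‖ ≤ 9 / 10 * (RI.c * RI.pek)))
    -- (G)
    (hLG : ∀ t ∈ terms, (RG.O t).Laws)
    (hread : ∀ t ∈ terms, ∀ prev u' v, DeltaAx u' → (1 / 2 : ℝ) * gaugeForm (T t) (cfg (uOrig Λ s t u' v)) = gLHS RG t prev u' v)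
    -- (S)
    (R : RotationReading P k ι)
    (hQread : ∀ t ∈ terms, ∀ prev u' v φ ψ, DeltaAx u' →
      Qφ t prev (uOrig Λ s t u' v) (phiOrig Λ s lamφ c t prev u' v φ ψ) =
        R.QB t prev ((T t).uk prev (cfg (uOrig Λ s t u' v))) (phiOrig Λ s lamφ c t prev u' v φ ψ))
    (hQcov : ∀ t ∈ terms, ∀ prev u' v φ ψ, DeltaAx u' →
      R.QB t prev (ukRot R T Λ s t prev u' v) (phiRot R Λ s lamφ c t prev u' v φ ψ) =
        bgGaugePhi R.ek (R.lamL t prev u' v)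
          (R.QB t prev ((T t).uk prev (cfg (uOrig Λ s t u' v))) (phiOrig Λ s lamφ c t prev u' v φ ψ)))
    (hΔ : ∀ t ∈ terms, ∀ prev u' v φ ψ, DeltaAx u' →
      scalarForm (T t) (ukRot R T Λ s t prev u' v) (phiRot R Λ s lamφ c t prev u' v φ ψ) =
        scalarForm (T t) ((T t).uk prev (cfg (uOrig Λ s t u' v))) (phiOrig Λ s lamφ c t prev u' v φ ψ))
    (hPread : ∀ t ∈ terms, ∀ prev u' v φ ψ, DeltaAx u' →
      (T t).Ploc prev (cfg (uOrig Λ s t u' v)) (phiOrig Λ s lamφ c t prev u' v φ ψ) =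
        R.PB t prev ((T t).uk prev (cfg (uOrig Λ s t u' v))) (phiOrig Λ s lamφ c t prev u' v φ ψ))
    (hPinv : ∀ t ∈ terms, ∀ prev u' v φ ψ, DeltaAx u' →
      R.PB t prev (ukRot R T Λ s t prev u' v) (phiRot R Λ s lamφ c t prev u' v φ ψ) =
        R.PB t prev ((T t).uk prev (cfg (uOrig Λ s t u' v))) (phiOrig Λ s lamφ c t prev u' v φ ψ))
    (F : ι → Prev P k → GaugeField P k U1 → GaugeField P (k+1) U1 → HiggsField P k → HiggsField P (k+1) → ℝ → ℝ) (nbar : ℕ)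
    (δR : Entry P k ι ℝ) (hLS : ∀ t ∈ terms, ∀ prev u' v, (RS.O t prev u' v).Laws)
    (hreadS : ∀ t ∈ terms, ∀ prev u' v φ ψ, DeltaAx u' →
      F t prev u' v φ ψ 0 = sMid2 RS t prev u' v φ ψ + D.Pkloc t prev u' v φ ψ)
    -- (Z)
    (ek η : ℝ) (lamZ : ι → Prev P k → GaugeField P k U1 → GaugeField P (k+1) U1 → Balaban1983to89.Site P 0 → ℝ)
    (hZv : ∀ t ∈ terms, ∀ j, (T t).Zv j = RZ.Zv t j)
    (hZaway : ∀ t ∈ terms, ∀ prev u' v, DeltaAx u' → ∀ j,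
      (T t).Zs j ((T t).uk prev (cfg (uOrig Λ s t u' v))) =
        (T t).Zs j (bgGaugeU ek η (lamZ t prev u' v) ((T t).uk prev (cfg (uOrig Λ s t u' v)))))
    (hZread : ∀ t ∈ terms, ∀ prev u' v, DeltaAx u' → ∀ j,
      (T t).Zs j (bgGaugeU ek η (lamZ t prev u' v) ((T t).uk prev (cfg (uOrig Λ s t u' v)))) = Zloc (RZ.Mf j t prev u' v) 1)
    (hM : ∀ t ∈ terms, ∀ j prev u' v, ∀ e' ∈ Set.uIcc (0 : ℝ) 1, (RZ.Mf j t prev u' v e').PosDef)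
    (hC : ∀ t ∈ terms, ∀ j prev u' v, ∀ i i', ContDiffOn ℝ (RZ.nbar + 1 : ℕ) (fun e' => RZ.Mf j t prev u' v e' i i') (Set.uIcc 0 1)) :
    IsDT (axialMeasure P k U1) terms Λ qU
        (bracket596 (fill41 (fillSteps D RG RS ⟨sMid1 R T a Λ s lamφ lamψ c, F, nbar, δR⟩ RZ) T w a Λ s lamφ lamψ c (chiIns RI)))
        (rho596 terms Λ (renamedBracket Qφ a (rho528 w T) Λ lamφ lamψ)) ∧
      ∫ v, ∫ ψ, rho596 terms Λ (renamedBracket Qφ a (rho528 w T) Λ lamφ lamψ) v ψ ∂volume ∂fieldMeasure P (k+1) U1 =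
        ∫ v, ∫ ψ, ρL v ψ ∂volume ∂fieldMeasure P (k+1) U1 :=
  eq596_bySteps D T a Qφ Λ s lamφ lamψ c RG RS RZ w hk h528 hρi hmφ hmψ hs S hsupp hQS (chiIns RI)
    (hins_of_bounds RI T w Λ s lamφ lamψ c hpos hbounds) hLG hread R hQread hQcov hΔ hPread hPinv F nbar δR hLS hreadS ek η lamZ hZv
    hZaway hZread hM hC

end WithInsertions

end

end Literature.MathematicalPhysics.QuantumFieldTheory.BalabanImbrieJaffe1984to88.BIJ88Eq596BySteps
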